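import Summits.Parity.BatemanHorn.Theorems.NormalFamilyBound.Negative.RealAxis

/-!
# `NormalFamilyBound` — negative lemmas IV: no uniformity in `f`, no proof by the triangle inequality,
and what a real point of the crux contains

Support (negative side) for crux `stmt-Parity-9769`
(`Summit.Parity.BatemanHorn.Theses.SelbergDelangeRigidity.NormalFamilyBound`), vocabulary of
`Negative/RealAxis.lean` (`V`, `H`, `Ωf`, `locallyBoundedSystems`, `fX`). Three cheap facts every prover of the
crux should know (standing disprover, cycle 2):

* `normalFamilyBound_not_uniform_in_f` / `not_normalFamilyBound_uniform` — UNIFORMITY IN `f` IS FALSE: at any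
  single `x ≥ 1` and the single real point `a = 3/2`, `‖H_x(3/2)‖` is unbounded over the degree-one
  Bateman–Horn systems `(X + c)` (`c = 2^m − x` puts the value `2^m` at `n = x`; `isBatemanHornSystem_fXadd`).
  So `M, r` must depend on the height of `f`, not only on `k` and the degrees (the crude shadow of the
  Friedlander–Granville uniformity barrier; the crux itself lets `η, M, r` depend on `f` and is untouched).
* `Habs_not_locallyBoundedOn` / `not_normalFamilyBound_abs` — THE TRIANGLE INEQUALITY IS HOPELESS: the majorant
  `Habs_x(z) = x⁻¹ (log x)^{k(1−Re z)} Σ_n |z|^{Ω_f(n)}` (`norm_H_le_Habs`) is, for EVERY system with `k ≥ 1` and EVERY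
  `η > 0`, unbounded at the point `e^{iθ} ∈ V_η` of the unit circle (`Σ_n 1 = x + 1`, normaliser
  `(log x)^{k(1−cos θ)} → ∞`): the saving `(log x)^{k(|z|−Re z)}` over the trivial bound must come from
  cancellation among the phases `e^{iθ Ω_f(n)}` — the route's exchange rate is real.
* `card_primeTuples_le_of_mem_locallyBoundedSystems` — CALIBRATION of a REAL point `0 < ε < 7/4` of the crux:
  `‖H_x(ε)‖ ≤ M` is the upper-bound-sieve estimate `#{n ≤ x : all f_i(n) prime} ≤ M ε^{−k} x (log x)^{−k(1−ε)}`
  (Brun–Titchmarsh order up to `(log x)^{kε}`; the real segment is sieve-strength, known by Nair–Tenenbaum;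
  the parity content of the crux sits off the segment).

Standing disprover's work file: `Summits/Parity/BatemanHorn/Cruxes/NormalFamilyBound/Disproof.lean`.
-/

namespace Summit.Parity.BatemanHorn.Theorems.NormalFamilyBound.Negative

open Literature.NumberTheory.Sieve Polynomial Finset Filter
open Summit.Parity.BatemanHorn.Theses.SelbergDelangeRigidity
open Summit.Parity.BatemanHorn.Theorems.SystemLSDRealSegment.Negative (tendsto_loglog_atTop)

noncomputable section

/-! ## A. Uniformity in `f` is false: the translates `X + c` -/

/-- `ω_{X+c}(p) ≤ 1 < p`: two residues `a, b < p` with `p ∣ a + c`, `p ∣ b + c` coincide. [folklore] -/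
theorem polyRootCountMod_fXadd_le_one (c : ℤ) (p : ℕ) :
    polyRootCountMod (![X + C c] : Fin 1 → ℤ[X]) p ≤ 1 := by
  unfold polyRootCountMod
  refine Finset.card_le_one.mpr fun a ha b hb => ?_
  simp only [mem_filter, mem_range, Fin.prod_univ_one, Matrix.cons_val_fin_one, eval_add, eval_X,
    eval_C] at ha hb
  have hdvd : (p : ℤ) ∣ (a : ℤ) - (b : ℤ) := by
    have := dvd_sub ha.2 hb.2
    simpa using this
  have habs : |(a : ℤ) - (b : ℤ)| < (p : ℤ) := by
    rw [abs_lt]; constructor <;> omega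
  have := Int.eq_zero_of_abs_lt_dvd hdvd habs
  omega

/-- The translate `(X + c)` IS a Bateman–Horn system for every `c : ℤ` (degree 1, `k = 1`). [folklore] -/
theorem isBatemanHornSystem_fXadd (c : ℤ) : IsBatemanHornSystem (![X + C c] : Fin 1 → ℤ[X]) where
  irreducible i := by
    fin_cases i
    simpa using irreducible_X_sub_C (-c)
  leadingCoeff_pos i := by
    fin_cases i
    show 0 < (X + C c : ℤ[X]).leadingCoeff
    rw [leadingCoeff_X_add_C]; exact one_pos
  pairwise_not_associated := Subsingleton.pairwise
  hasNoFixedPrimeDivisor p hp := (polyRootCountMod_fXadd_le_one c p).trans_lt hp.one_lt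

/-- `Ω_{X+c}(n) = Ω(toNat (n + c))`. [folklore] -/
theorem Ωf_fXadd (c : ℤ) (n : ℕ) :
    Ωf (![X + C c] : Fin 1 → ℤ[X]) n = ArithmeticFunction.cardFactors ((n : ℤ) + c).toNat := by
  simp [Ωf]

/-- At a FIXED `x ≥ 1` and the real point `a = 3/2`, the translate `f = (X + (2^m − x))` has the single
term `n = x ↦ (3/2)^{Ω(2^m)} = (3/2)^m`, so `‖H_x(3/2)‖ ≥ x⁻¹ (log x)^{−1/2} (3/2)^m`. [folklore] -/
theorem norm_H_fXadd_ge (x : ℕ) (m : ℕ) :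
    (x : ℝ)⁻¹ * Real.exp ((1 : ℕ) * (1 - (3 / 2 : ℝ)) * Real.log (Real.log x)) * (3 / 2 : ℝ) ^ m ≤
      ‖H 1 (![X + C (2 ^ m - x : ℤ)] : Fin 1 → ℤ[X]) x (3 / 2 : ℝ)‖ := by
  set F : Fin 1 → ℤ[X] := ![X + C (2 ^ m - x : ℤ)] with hF
  rw [norm_H_ofReal _ _ _ (by norm_num)]
  have hterm : (3 / 2 : ℝ) ^ Ωf F x ≤ ∑ n ∈ range (x + 1), (3 / 2 : ℝ) ^ Ωf F n :=
    single_le_sum (f := fun n => (3 / 2 : ℝ) ^ Ωf F n) (fun n _ => by positivity) (by simp)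
  have hΩ : Ωf F x = m := by
    rw [hF]
    rw [Ωf_fXadd]
    have : ((x : ℕ) : ℤ) + (2 ^ m - x) = ((2 ^ m : ℕ) : ℤ) := by push_cast; ring
    rw [this, Int.toNat_natCast, ArithmeticFunction.cardFactors_apply_prime_pow Nat.prime_two]
  rw [hΩ] at hterm
  gcongr

/-- UNIFORMITY IN `f` IS FALSE, already at ONE `x ≥ 1` and ONE point: no constant bounds `‖H_x(3/2)‖` over
the Bateman–Horn systems `(X + c)` of degree one (`c = 2^m − x`: the value `2^m` sits at `n = x`). So the
constants `M, r` of the crux must depend on (the height of) `f`, not only on `k` and the degrees — the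
crude shadow of the Friedlander–Granville phenomenon (`Literature.Barriers.Parity.UniformBatemanHornBarrier`);
the crux, which lets `η, M, r` depend on `f`, is untouched. [folklore] -/
theorem normalFamilyBound_not_uniform_in_f (x : ℕ) (hx : 1 ≤ x) :
    ¬ ∃ M : ℝ, ∀ f : Fin 1 → ℤ[X], IsBatemanHornSystem f → ‖H 1 f x (3 / 2 : ℝ)‖ ≤ M := by
  rintro ⟨M, hM⟩
  set c : ℝ := (x : ℝ)⁻¹ * Real.exp ((1 : ℕ) * (1 - (3 / 2 : ℝ)) * Real.log (Real.log x)) with hc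
  have hc0 : 0 < c := by
    have : (0 : ℝ) < x := by exact_mod_cast hx
    positivity
  obtain ⟨m, hm⟩ := pow_unbounded_of_one_lt (M / c) (by norm_num : (1 : ℝ) < 3 / 2)
  have h1 := norm_H_fXadd_ge x m
  have h2 := hM _ (isBatemanHornSystem_fXadd (2 ^ m - x : ℤ))
  rw [div_lt_iff₀ hc0] at hm
  rw [← hc] at h1
  linarith [mul_comm c ((3 / 2 : ℝ) ^ m)]

/-- REFUTED STRENGTHENING: the crux made UNIFORM in `f` (`η, M, r` depending on `k` only) is false
(`k = 1`, `a = 3/2`, `x = 1`, `f = (X + 2^m − 1)`). [folklore] -/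
theorem not_normalFamilyBound_uniform :
    ¬ ∀ k : ℕ, ∃ η : ℝ, 0 < η ∧ η ≤ 1 / 4 ∧ ∀ a ∈ V (7 / 4) η, ∃ M : ℝ, ∃ r > (0 : ℝ),
      ∀ f : Fin k → ℤ[X], IsBatemanHornSystem f →
        ∀ x : ℕ, ∀ z ∈ Metric.ball a r ∩ V (7 / 4) η, ‖H k f x z‖ ≤ M := by
  intro h
  obtain ⟨η, hη, -, hB⟩ := h 1
  have haV : ((3 / 2 : ℝ) : ℂ) ∈ V (7 / 4) η := by
    refine ⟨?_, ?_, ?_⟩ <;> simp <;> linarith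
  obtain ⟨M, r, hr, hM⟩ := hB _ haV
  exact normalFamilyBound_not_uniform_in_f 1 le_rfl
    ⟨M, fun f hf => hM f hf 1 _ ⟨Metric.mem_ball_self hr, haV⟩⟩

/-! ## B. The triangle inequality is hopeless off the real axis: the absolute family -/

/-- The triangle-inequality MAJORANT `Habs_x(z) := x⁻¹ (log x)^{k(1 − Re z)} Σ_{n ≤ x} |z|^{Ω_f(n)}` of `‖H_x(z)‖`:
what taking norms inside the sum gives (written out in full in every statement below). [folklore] -/
theorem norm_H_le_Habs (k : ℕ) (f : Fin k → ℤ[X]) (x : ℕ) (z : ℂ) :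
    ‖H k f x z‖ ≤ (x : ℝ)⁻¹ * Real.exp (k * (1 - z.re) * Real.log (Real.log x)) * ∑ n ∈ range (x + 1), ‖z‖ ^ Ωf f n := by
  set L : ℝ := Real.log (Real.log x)
  simp only [H, norm_mul, norm_inv, Complex.norm_natCast, Complex.norm_exp]
  have hre : ((k : ℂ) * (1 - z) * (L : ℂ)).re = k * (1 - z.re) * L := by
    simp [Complex.mul_re, Complex.mul_im]
  rw [hre]
  gcongr
  refine (norm_sum_le _ _).trans (le_of_eq ?_)
  simp [Ωf, norm_pow]

/-- On the unit circle the majorant forgets `f`: `Habs_x(z) = x⁻¹ (x+1) (log x)^{k(1 − Re z)}`. [folklore] -/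
theorem Habs_of_norm_eq_one (k : ℕ) (f : Fin k → ℤ[X]) (x : ℕ) {z : ℂ} (hz : ‖z‖ = 1) :
    (x : ℝ)⁻¹ * Real.exp (k * (1 - z.re) * Real.log (Real.log x)) * ∑ n ∈ range (x + 1), ‖z‖ ^ Ωf f n =
      (x : ℝ)⁻¹ * Real.exp (k * (1 - z.re) * Real.log (Real.log x)) * (x + 1) := by
  simp [hz]

/-- For `|z| = 1`, `Re z < 1`, `k ≥ 1` the majorant is unbounded in `x` for EVERY system `f`:
`Habs_x(z) ≥ (log x)^{k(1 − Re z)} → ∞`. [folklore] -/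
theorem Habs_unbounded {k : ℕ} (hk : 1 ≤ k) (f : Fin k → ℤ[X]) {z : ℂ} (hz : ‖z‖ = 1) (hre : z.re < 1) :
    ∀ M : ℝ, ∃ x : ℕ, M < (x : ℝ)⁻¹ * Real.exp (k * (1 - z.re) * Real.log (Real.log x)) * ∑ n ∈ range (x + 1), ‖z‖ ^ Ωf f n := by
  have ht : Tendsto (fun x : ℕ => Real.exp (k * (1 - z.re) * Real.log (Real.log x))) atTop atTop := by
    refine Real.tendsto_exp_atTop.comp (tendsto_loglog_atTop.const_mul_atTop ?_)
    have : (1 : ℝ) ≤ k := by exact_mod_cast hk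
    nlinarith
  intro M
  obtain ⟨x, hx1, hxM⟩ := ((eventually_ge_atTop 1).and (ht.eventually_gt_atTop M)).exists
  refine ⟨x, hxM.trans_le ?_⟩
  rw [Habs_of_norm_eq_one k f x hz]
  have hx' : (0 : ℝ) < x := by exact_mod_cast hx1
  set E : ℝ := Real.exp (k * (1 - z.re) * Real.log (Real.log x))
  have h1 : E ≤ E * ((x : ℝ)⁻¹ * (x + 1)) :=
    le_mul_of_one_le_right (Real.exp_nonneg _) (by rw [le_inv_mul_iff₀ hx']; linarith)
  calc E ≤ E * ((x : ℝ)⁻¹ * (x + 1)) := h1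
    _ = (x : ℝ)⁻¹ * E * (x + 1) := by ring

/-- Every thin rectangle `V_{7/4,η}` contains a point of the unit circle other than `1`:
`z = e^{iθ}`, `θ = min(η/2, 1)`. [folklore] -/
theorem exists_mem_V_norm_eq_one {η : ℝ} (hη : 0 < η) :
    ∃ z ∈ V (7 / 4) η, ‖z‖ = 1 ∧ z.re < 1 := by
  set θ : ℝ := min (η / 2) 1 with hθ
  have hθ0 : 0 < θ := lt_min (by linarith) one_pos
  have hθ1 : θ ≤ 1 := min_le_right _ _
  have hθη : θ ≤ η / 2 := min_le_left _ _
  have hpi : (1 : ℝ) < Real.pi / 2 := by have := Real.pi_gt_three; linarith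
  refine ⟨Complex.exp (θ * Complex.I), ⟨?_, ?_, ?_⟩, Complex.norm_exp_ofReal_mul_I θ, ?_⟩
  · rw [Complex.exp_ofReal_mul_I_re]
    have : 0 < Real.cos θ := Real.cos_pos_of_mem_Ioo ⟨by linarith, by linarith⟩
    linarith
  · rw [Complex.exp_ofReal_mul_I_re]
    have := Real.cos_le_one θ
    linarith
  · rw [Complex.exp_ofReal_mul_I_im]
    have h1 : |Real.sin θ| ≤ |θ| := Real.abs_sin_le_abs
    rw [abs_of_pos hθ0] at h1
    linarith
  · rw [Complex.exp_ofReal_mul_I_re]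
    have := Real.cos_lt_cos_of_nonneg_of_le_pi_div_two le_rfl (by linarith) hθ0
    rwa [Real.cos_zero] at this

/-- THE TRIANGLE INEQUALITY IS HOPELESS: for EVERY system `f` with `k ≥ 1` (Bateman–Horn or not) and
EVERY `η > 0`, the majorant family `Habs` is NOT locally bounded on `V_{7/4,η}` — it blows up at the
point `e^{iθ} ∈ V_η` of the unit circle, where `Σ_n |z|^{Ω_f(n)} = x + 1` exactly and the normaliser
`(log x)^{k(1 − cos θ)}` diverges. Any proof of the crux must produce the cancellation
`(log x)^{k(|z| − Re z)}` among the phases `e^{iθ Ω_f(n)}` (the route's exchange rate is real, not an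
artefact of a lossy bound). [folklore] -/
theorem Habs_not_locallyBoundedOn {k : ℕ} (hk : 1 ≤ k) (f : Fin k → ℤ[X]) {η : ℝ} (hη : 0 < η) :
    ¬ ∀ a ∈ V (7 / 4) η, ∃ M : ℝ, ∃ r > (0 : ℝ), ∀ x : ℕ, ∀ z ∈ Metric.ball a r ∩ V (7 / 4) η,
      (x : ℝ)⁻¹ * Real.exp (k * (1 - z.re) * Real.log (Real.log x)) * ∑ n ∈ range (x + 1), ‖z‖ ^ Ωf f n ≤ M := by
  intro hB
  obtain ⟨z₀, hV, hz1, hre⟩ := exists_mem_V_norm_eq_one hη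
  obtain ⟨M, r, hr, hM⟩ := hB z₀ hV
  obtain ⟨x, hx⟩ := Habs_unbounded hk f hz1 hre M
  have := hM x z₀ ⟨Metric.mem_ball_self hr, hV⟩
  linarith

/-- REFUTED STRENGTHENING: the crux with `‖H_x(z)‖` replaced by its triangle-inequality majorant `Habs` is
false (witness: the genuine Bateman–Horn system `f = (X)`, any `η`). [folklore] -/
theorem not_normalFamilyBound_abs :
    ¬ ∀ (k : ℕ) (f : Fin k → ℤ[X]), IsBatemanHornSystem f → ∃ η : ℝ, 0 < η ∧ η ≤ 1 / 4 ∧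
      ∀ a ∈ V (7 / 4) η, ∃ M : ℝ, ∃ r > (0 : ℝ), ∀ x : ℕ, ∀ z ∈ Metric.ball a r ∩ V (7 / 4) η,
        (x : ℝ)⁻¹ * Real.exp (k * (1 - z.re) * Real.log (Real.log x)) * ∑ n ∈ range (x + 1), ‖z‖ ^ Ωf f n ≤ M := by
  intro h
  obtain ⟨η, hη, -, hB⟩ := h 1 fX isBatemanHornSystem_fX
  exact Habs_not_locallyBoundedOn le_rfl fX hη hB

/-! ## C. Calibration: the real point `ε` of the crux is an upper-bound sieve -/

/-- If every `f_i(n)` is a prime then `Ω_f(n) = k`. [folklore] -/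
theorem Ωf_eq_of_forall_prime {k : ℕ} (f : Fin k → ℤ[X]) {n : ℕ}
    (h : ∀ i, (((f i).eval (n : ℤ)).toNat).Prime) : Ωf f n = k := by
  simp only [Ωf]
  rw [Finset.sum_congr rfl fun i _ => ArithmeticFunction.cardFactors_apply_prime (h i)]
  simp

/-- CALIBRATION (what the crux contains at a REAL point `0 < ε < 7/4`): a bound `‖H_x(ε)‖ ≤ M` for all
`x` gives the upper-bound-sieve estimate `#{n ≤ x : every f_i(n) prime} ≤ M ε^{−k} · x · (log x)^{−k(1−ε)}`
(`x ≥ 1`). For `ε → 0` this is the Brun–Titchmarsh / Selberg order `x (log x)^{−k}` up to `(log x)^{kε}`: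
the real segment of the crux is sieve-strength information (known: Nair–Tenenbaum), the parity content
sits off the segment. [folklore] -/
theorem card_primeTuples_le_of_norm_H_le {k : ℕ} (f : Fin k → ℤ[X]) {ε M : ℝ} (hε : 0 < ε)
    (hM : ∀ x : ℕ, ‖H k f x ε‖ ≤ M) (x : ℕ) (hx : 1 ≤ x) :
    (#((range (x + 1)).filter fun n : ℕ => ∀ i, (((f i).eval (n : ℤ)).toNat).Prime) : ℝ) ≤
      M * (ε⁻¹) ^ k * x * Real.exp (-(k * (1 - ε) * Real.log (Real.log x))) := by
  set P := (range (x + 1)).filter fun n : ℕ => ∀ i, (((f i).eval (n : ℤ)).toNat).Prime with hP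
  set E : ℝ := Real.exp (k * (1 - ε) * Real.log (Real.log x)) with hE
  have hx' : (0 : ℝ) < x := by exact_mod_cast hx
  have hE0 : 0 < E := Real.exp_pos _
  have h1 := hM x
  rw [norm_H_ofReal _ _ _ hε.le] at h1
  -- the sum dominates ε^k · #P
  have hsum : ε ^ k * (#P : ℝ) ≤ ∑ n ∈ range (x + 1), ε ^ Ωf f n := by
    calc ε ^ k * (#P : ℝ) = ∑ n ∈ P, ε ^ k := by rw [sum_const, nsmul_eq_mul, mul_comm]
      _ = ∑ n ∈ P, ε ^ Ωf f n := by
          refine sum_congr rfl fun n hn => ?_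
          rw [Ωf_eq_of_forall_prime f (mem_filter.mp hn).2]
      _ ≤ ∑ n ∈ range (x + 1), ε ^ Ωf f n :=
          sum_le_sum_of_subset_of_nonneg (filter_subset _ _) fun n _ _ => by positivity
  have h2 : (x : ℝ)⁻¹ * E * (ε ^ k * (#P : ℝ)) ≤ M := by
    refine le_trans ?_ h1
    gcongr
  -- rearrange
  have hεk : 0 < ε ^ k := pow_pos hε k
  rw [Real.exp_neg, ← hE, inv_pow]
  have : (#P : ℝ) = ((x : ℝ)⁻¹ * E * (ε ^ k * (#P : ℝ))) * ((ε ^ k)⁻¹ * x * E⁻¹) := by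
    field_simp
  rw [this]
  calc (x : ℝ)⁻¹ * E * (ε ^ k * (#P : ℝ)) * ((ε ^ k)⁻¹ * x * E⁻¹)
      ≤ M * ((ε ^ k)⁻¹ * x * E⁻¹) := by gcongr
    _ = M * (ε ^ k)⁻¹ * x * E⁻¹ := by ring

/-- The crux at a real point, for members of `locallyBoundedSystems`: prime `k`-tuples of values are
`O_{f,ε}(x (log x)^{−k(1−ε)})` for every `0 < ε < 7/4`. [folklore] -/
theorem card_primeTuples_le_of_mem_locallyBoundedSystems {k : ℕ} {f : Fin k → ℤ[X]}
    (hf : f ∈ locallyBoundedSystems (7 / 4) k) {ε : ℝ} (hε0 : 0 < ε) (hε1 : ε < 7 / 4) :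
    ∃ M : ℝ, ∀ x : ℕ, 1 ≤ x →
      (#((range (x + 1)).filter fun n : ℕ => ∀ i, (((f i).eval (n : ℤ)).toNat).Prime) : ℝ) ≤
        M * (ε⁻¹) ^ k * x * Real.exp (-(k * (1 - ε) * Real.log (Real.log x))) := by
  obtain ⟨η, hη, -, hB⟩ := hf
  have haV : ((ε : ℝ) : ℂ) ∈ V (7 / 4) η := by
    refine ⟨?_, ?_, ?_⟩ <;> simp <;> linarith
  obtain ⟨M, r, hr, hM⟩ := hB _ haV
  exact ⟨M, fun x hx => card_primeTuples_le_of_norm_H_le f hε0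
    (fun x => hM x _ ⟨Metric.mem_ball_self hr, haV⟩) x hx⟩

end

end Summit.Parity.BatemanHorn.Theorems.NormalFamilyBound.Negative
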